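import Summits.QuantumFields.YangMills.Theorems.LuscherReductionDressedRitzPolyakovLiftShadowChart
import Summits.QuantumFields.YangMills.Theorems.LuscherReductionDressedRitzPolyakovLiftShadowKernelMoment
import Mathlib.Analysis.Calculus.ContDiff.RCLike
import HarnessLib

/-!
# Crux `DressedRitz` (stmt-QuantumFields-20205), line «polyakovlift» r6, wave 2 / F8c part 2 — ★ THE SHADOW OBSERVABLE IS LIPSCHITZ:
# `(g(U^L) − g(V^L))² ≤ Lg·L²·cfgDist U V` off the equator, `Lg` INDEPENDENT of `L`

Support module (fleet seat ym-20205-polyakovlift-s1 gen 2, for the LEAD's wave-2 brief W2-F8 (c) of `WAVE-2-BRIEFS.md`; `--supports stmt-QuantumFields-20205`,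
helper, no closure claim).  `g = transplantObsL L Λ R f i = transplantFn R f i ∘ rootCoord L (Λ/2)` (p554989), shadow observable `g ∘ powLink L`.  With
parts 1a/1b (`…ShadowChartRadial`, `…ShadowChart`: the root chart is Lipschitz on the polar caps uniformly in `L`; `‖U^L − V^L‖_F ≤ L‖U − V‖_F`) and F8b
(`…ShadowKernelMoment`: `cfgDist`), this file assembles the bound the energy-norm product lemma (F8a) consumes:

* §1 `exists_lipschitzWith_transplantFn` — the flat observable `χ_R·f_{i+1}/f_0` is `C¹` with compact support, hence Lipschitz (Mathlib) and bounded;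
* §2 ★ `abs_scalarPart_ge_of_transplantObsL_ne_zero` — SUPPORT ⇒ POLAR CAP: if `g(W⃗) ≠ 0` and `W⃗` is off the equator then every link has `|u₀| ≥ 15/16`
  (`χ_R ≠ 0 ⇒ ‖y‖ < √2R`, `‖y_j‖ = ψ_L(|gn W_j|)/μ ≥ arctan(|gn W_j|)/μ`, `μ√2R ≤ √2/8 < 0.18`, `tan 0.18 ≤ 0.36`, `u₀²(1+|gn|²) = 1`);
  `scalarPart_close` — a link within `‖W − W'‖_F² ≤ 1/16` of a cap link `|u₀| ≥ 15/16` lies in the cap `|u₀'| ≥ 3/4` with the same sign;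
* §3 `capFlip` — flipping the negative links by the centre `−1` does not change `rootCoord` (the gnomonic coordinate is central) and preserves same-sign
  Hilbert–Schmidt distances;
* §4 ★★ `shadowObs_sub_sq_le` — for `W⃗, W⃗'` off the equator: `(g(W⃗) − g(W⃗'))² ≤ Lg·Σ_e ‖W_e − W'_e‖_F²` with `Lg = 114K²/μ² + 64C²` (`K` = Lipschitz constant,
  `C` = sup of the flat observable, `μ = Λ/2`) — three cases: both zero ∕ a far link (`> 1/16`, crude bound `4C²`) ∕ all links close (chart Lipschitz on the caps);
* §5 ★★★ `shadowObs_powLink_sub_sq_le` — **`(g(U^L) − g(V^L))² ≤ Lg·L²·cfgDist U V`** for `U, V` whose `L`-th powers are off the equator (a null set, part 3),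
  every `L ≥ 1`, the SAME `Lg` (depends on `Λ, R, f, i` only).

HONEST FRAMING: chart calculus at fixed lattice on the conditional femto rung R2b1; serves ONE stub's (S-PSCAL″) soft error; nothing here bears on infinite volume,
the continuum limit or the Clay gap.
References: Bröcker–tom Dieck I (1.10) [cite: BrockerTomDieck1985, I (1.10)]; M. Lüscher, NPB 219 (1983) 233 [cite: Luscher1983, §2–§3].
-/

set_option autoImplicit false

noncomputable section

open MeasureTheory Filter Topology Real
open scoped Matrix ComplexConjugate BigOperators NNReal
open Literature.MathematicalPhysics.QuantumFieldTheory
open Literature.MathematicalPhysics.QuantumLattice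
open Literature.Analysis.OperatorTheory.YMMatrixModel

namespace Summit.QuantumFields.YangMills.Theorems.FemtoTransferGap.PolyakovLift

open Summit.QuantumFields.YangMills.Theorems.FemtoTransferGap
open Summit.QuantumFields.YangMills.Theorems.FemtoTransferGap.TwoLattice.Chart (frobNorm_sub_sq_eq)

variable {k : ℕ}

/-! ## §1 The flat observable is Lipschitz and bounded -/

/-- `transplantFn R f i = χ_R · f_{i+1}/f_0` is `C¹` (everything smooth, `f_0 > 0`). [folklore] -/
theorem contDiff_one_transplantFn (R : ℝ) {f : Fin (k + 1) → ZM → ℝ} (hf : IsEigenFamily k f) (hpos : ∀ x, 0 < f 0 x) (i : Fin k) :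
    ContDiff ℝ ((1 : ℕ∞) : WithTop ℕ∞) (transplantFn R f i) := by
  unfold transplantFn
  exact (radialCutoff_contDiff R).mul ((hf.1 i.succ 1).div (hf.1 0 1) fun x => (hpos x).ne')

/-- ★ The flat observable is LIPSCHITZ (a `C¹` function with compact support) and BOUNDED. [folklore] -/
theorem exists_lipschitzWith_transplantFn {R : ℝ} (hR : 0 < R) {f : Fin (k + 1) → ZM → ℝ} (hf : IsEigenFamily k f) (hpos : ∀ x, 0 < f 0 x)
    (i : Fin k) : ∃ K : ℝ≥0, ∃ C : ℝ, 0 ≤ C ∧ LipschitzWith K (transplantFn R f i) ∧ ∀ y, |transplantFn R f i y| ≤ C := by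
  obtain ⟨K, hK⟩ := (contDiff_one_transplantFn R hf hpos i).lipschitzWith_of_hasCompactSupport (hasCompactSupport_transplantFn hR f i) (by simp)
  obtain ⟨-, ⟨C, hC⟩, -⟩ := transplantFn_props hR hf hpos i
  exact ⟨K, max C 0, le_max_right _ _, hK, fun y => (hC y).trans (le_max_left _ _)⟩

/-! ## §2 Support forces the polar cap; closeness keeps it -/

/-- `‖linkVec y i‖ ≤ ‖y‖`. [folklore] -/
theorem norm_linkVec_le_norm (y : ZM) (i : Fin 3) : ‖linkVec y i‖ ≤ ‖y‖ := by
  have h : ‖linkVec y i‖ ^ 2 ≤ ‖y‖ ^ 2 := by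
    rw [norm_sq_eq_sum_linkVec]
    exact Finset.single_le_sum (f := fun j => ‖linkVec y j‖ ^ 2) (fun _ _ => sq_nonneg _) (Finset.mem_univ i)
  exact (pow_le_pow_iff_left₀ (norm_nonneg _) (norm_nonneg _) two_ne_zero).1 h

/-- The link norms of the root chart: `‖(rootCoord L μ U)_j‖ = rootPsi L |gn U_j| / μ` (`μ > 0`, `L ≥ 1`). [cite: Luscher1983, §2] -/
theorem norm_linkVec_rootCoord {L : ℕ} (hL : 1 ≤ L) {μ : ℝ} (hμ : 0 < μ) (U : Cfg) (j : Fin 3) :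
    ‖linkVec (rootCoord L μ U) j‖ = rootPsi L (gnNorm (U (edgeOf j))) / μ := by
  unfold rootCoord
  rw [linkVec_rootRescale, mul_norm_linkVec_gnCoord hμ, norm_smul, Real.norm_eq_abs,
    abs_of_nonneg (rootProfile_nonneg hL (gnNorm_nonneg _))]
  have hn : ‖linkVec (gnCoord μ U) j‖ = gnNorm (U (edgeOf j)) / μ := by
    rw [eq_div_iff hμ.ne', mul_comm]; exact mul_norm_linkVec_gnCoord hμ U j
  rw [hn, ← mul_div_assoc, rootProfile_mul_self]

/-- `√2/8 < 9/50`. [folklore] -/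
theorem sqrt_two_div_eight_lt : Real.sqrt 2 / 8 < 9 / 50 := by
  have h : Real.sqrt 2 < 36 / 25 := by
    rw [show (36 / 25 : ℝ) = Real.sqrt ((36 / 25) ^ 2) by rw [Real.sqrt_sq (by norm_num)]]
    exact Real.sqrt_lt_sqrt (by norm_num) (by norm_num)
  linarith

/-- ★ **Support ⇒ polar cap.**  If `g(W⃗) = transplantObsL L Λ R f i W⃗ ≠ 0` (`L ≥ 1`, `0 < Λ`, `1 ≤ R`, `RΛ ≤ 1/4`) and every link of `W⃗` is off the equator, then
every link has `|u₀| ≥ 15/16`. [cite: Luscher1983, §2–§3] -/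
theorem abs_scalarPart_ge_of_transplantObsL_ne_zero {L : ℕ} (hL : 1 ≤ L) {Λ R : ℝ} (hΛ : 0 < Λ) (hR1 : 1 ≤ R) (hRΛ : R * Λ ≤ 1 / 4)
    (f : Fin (k + 1) → ZM → ℝ) (i : Fin k) {U : Cfg} (hoff : ∀ e, scalarPart (U e) ≠ 0) (hne : transplantObsL L Λ R f i U ≠ 0) (j : Fin 3) :
    15 / 16 ≤ |scalarPart (U (edgeOf j))| := by
  have hR : 0 < R := lt_of_lt_of_le one_pos hR1
  set μ : ℝ := Λ / 2 with hμdef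
  have hμ : 0 < μ := by positivity
  set y := rootCoord L μ U with hy
  -- the cut-off does not vanish, so `‖y‖² < 2R²`
  have hχ : radialCutoff R y ≠ 0 := by
    intro h0
    apply hne
    show transplantFn R f i y = 0
    simp only [transplantFn, h0, zero_mul]
  have hnorm : ‖y‖ ^ 2 < 2 * R ^ 2 := by
    by_contra h
    exact hχ (radialCutoff_eq_zero hR (not_lt.1 h))
  -- the link norm is `ψ_L(t)/μ ≥ arctan(t)/μ`
  set t := gnNorm (U (edgeOf j)) with ht
  have ht0 : 0 ≤ t := gnNorm_nonneg _
  have hlink : rootPsi L t / μ < Real.sqrt 2 * R := by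
    have h1 : ‖linkVec y j‖ < Real.sqrt 2 * R := by
      have h2 : ‖linkVec y j‖ ^ 2 < (Real.sqrt 2 * R) ^ 2 := by
        calc ‖linkVec y j‖ ^ 2 ≤ ‖y‖ ^ 2 := pow_le_pow_left₀ (norm_nonneg _) (norm_linkVec_le_norm y j) 2
          _ < 2 * R ^ 2 := hnorm
          _ = (Real.sqrt 2 * R) ^ 2 := by rw [mul_pow, Real.sq_sqrt (by norm_num : (0:ℝ) ≤ 2)]
      exact lt_of_pow_lt_pow_left₀ 2 (by positivity) h2
    rwa [hy, norm_linkVec_rootCoord hL hμ U j] at h1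
  have harc : Real.arctan t < 9 / 50 := by
    have h1 : Real.arctan t < μ * (Real.sqrt 2 * R) := by
      have := arctan_le_rootPsi hL ht0
      have h2 : rootPsi L t < μ * (Real.sqrt 2 * R) := by rwa [div_lt_iff₀' hμ] at hlink
      linarith
    have h2 : μ * (Real.sqrt 2 * R) = Real.sqrt 2 / 8 * (4 * (R * Λ)) := by rw [hμdef]; ring
    have h3 : Real.sqrt 2 / 8 * (4 * (R * Λ)) ≤ Real.sqrt 2 / 8 * 1 :=
      mul_le_mul_of_nonneg_left (by linarith) (by positivity)
    linarith [sqrt_two_div_eight_lt]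
  -- hence `t < tan(9/50) ≤ 9/25`
  have hpi4 : (9 / 50 : ℝ) ≤ π / 4 := by linarith [Real.pi_gt_three]
  have htlt : t < 9 / 25 := by
    have h1 : t < Real.tan (9 / 50) := by
      have := Real.tan_lt_tan_of_lt_of_lt_pi_div_two (by linarith [Real.neg_pi_div_two_lt_arctan t]) (by linarith [Real.pi_gt_three]) harc
      rwa [Real.tan_arctan] at this
    have h2 : Real.tan (9 / 50) ≤ 9 / 25 := by
      have := tan_sub_tan_le_two_mul le_rfl (by norm_num : (0:ℝ) ≤ 9 / 50) hpi4
      rw [Real.tan_zero, sub_zero, sub_zero] at this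
      linarith
    linarith
  -- and `u₀²(1 + t²) = 1`
  have hid := scalarPart_sq_mul_one_add_gnNorm_sq (hoff (edgeOf j))
  rw [← ht] at hid
  have ht2 : t ^ 2 ≤ 81 / 625 := by nlinarith
  have hkey : 1 ≤ scalarPart (U (edgeOf j)) ^ 2 * (1 + 81 / 625) := by
    nlinarith [mul_nonneg (sq_nonneg (scalarPart (U (edgeOf j)))) (sub_nonneg.2 ht2)]
  have hs2 : (15 / 16 : ℝ) ^ 2 ≤ |scalarPart (U (edgeOf j))| ^ 2 := by rw [sq_abs]; nlinarith
  exact (pow_le_pow_iff_left₀ (by norm_num) (abs_nonneg _) two_ne_zero).1 hs2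

/-- **Closeness keeps the cap and the sign**: `|u₀(W)| ≥ 15/16` and `‖W − W'‖_F² ≤ 1/16` give `|u₀(W')| ≥ 3/4` and `u₀(W)·u₀(W') > 0`. [folklore] -/
theorem scalarPart_close {W W' : SU2} (hW : 15 / 16 ≤ |scalarPart W|)
    (hd : frobNorm ((W : Matrix (Fin 2) (Fin 2) ℂ) - (W' : Matrix (Fin 2) (Fin 2) ℂ)) ^ 2 ≤ 1 / 16) :
    3 / 4 ≤ |scalarPart W'| ∧ 0 < scalarPart W * scalarPart W' := by
  have h := frobNorm_sub_sq_eq W W'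
  have hv : 0 ≤ ∑ a, (vecPart W a - vecPart W' a) ^ 2 := Finset.sum_nonneg fun _ _ => sq_nonneg _
  have hss : (scalarPart W - scalarPart W') ^ 2 ≤ 1 / 32 := by nlinarith
  have habs : |scalarPart W - scalarPart W'| < 3 / 16 := by
    have : (scalarPart W - scalarPart W') ^ 2 < (3 / 16) ^ 2 := by nlinarith
    exact abs_lt_of_sq_lt_sq this (by norm_num)
  rcases le_or_gt 0 (scalarPart W) with hp | hn
  · rw [abs_of_nonneg hp] at hW
    have h1 : 3 / 4 < scalarPart W' := by linarith [(abs_lt.1 habs).2]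
    exact ⟨by rw [abs_of_pos (by linarith)]; linarith, by nlinarith⟩
  · rw [abs_of_neg hn] at hW
    have h1 : scalarPart W' < -(3 / 4) := by linarith [(abs_lt.1 habs).1]
    exact ⟨by rw [abs_of_neg (by linarith)]; linarith, by nlinarith⟩

/-! ## §3 Flipping negative links by the centre -/

/-- Flip every link with negative scalar part by the central element `−1`. [folklore] -/
def capFlip (U : Cfg) : Cfg := fun e => if scalarPart (U e) < 0 then negOne * U e else U e

/-- The flipped links have scalar part `|u₀|`. [folklore] -/
theorem scalarPart_capFlip (U : Cfg) (e : Edge 3 1) : scalarPart (capFlip U e) = |scalarPart (U e)| := by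
  unfold capFlip
  split_ifs with h
  · rw [scalarPart_negOne_mul, abs_of_neg h]
  · rw [abs_of_nonneg (not_lt.1 h)]

/-- The gnomonic coordinate is blind to the flip (it is a class function of `±W`). [folklore] -/
theorem gnCoord_capFlip (μ : ℝ) (U : Cfg) : gnCoord μ (capFlip U) = gnCoord μ U := by
  ext p
  simp only [gnCoord_apply, capFlip]
  split_ifs with h
  · rw [gnLink_negOne_mul]
  · rfl

/-- The root chart is blind to the flip. [folklore] -/
theorem rootCoord_capFlip (L : ℕ) (μ : ℝ) (U : Cfg) : rootCoord L μ (capFlip U) = rootCoord L μ U := by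
  unfold rootCoord; rw [gnCoord_capFlip]

/-- Same-sign links keep their Hilbert–Schmidt distance under the flip. [folklore] -/
theorem frobNorm_capFlip_sub {U V : Cfg} {e : Edge 3 1} (h : 0 < scalarPart (U e) * scalarPart (V e)) :
    frobNorm (((capFlip U e : SU2) : Matrix (Fin 2) (Fin 2) ℂ) - ((capFlip V e : SU2) : Matrix (Fin 2) (Fin 2) ℂ)) =
      frobNorm (((U e : SU2) : Matrix (Fin 2) (Fin 2) ℂ) - ((V e : SU2) : Matrix (Fin 2) (Fin 2) ℂ)) := by
  unfold capFlip
  by_cases hU : scalarPart (U e) < 0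
  · have hV : scalarPart (V e) < 0 := by
      by_contra hV
      push Not at hV
      nlinarith [mul_nonneg (neg_nonneg.2 hU.le) hV]
    rw [if_pos hU, if_pos hV, coe_negOne_mul, coe_negOne_mul, neg_sub_neg, ← neg_sub, frobNorm_neg]
  · have hV : ¬ scalarPart (V e) < 0 := by
      intro hV
      push Not at hU
      nlinarith [mul_nonneg hU (neg_nonneg.2 hV.le)]
    rw [if_neg hU, if_neg hV]

/-! ## §4 ★★ The root-transplanted observable is Lipschitz on `Cfg` off the equator -/

/-- `Σ_i F(edgeOf i) = Σ_e F e` on the one-site lattice. [folklore] -/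
theorem sum_edgeOf_eq {M : Type*} [AddCommMonoid M] (F : Edge 3 1 → M) : ∑ i : Fin 3, F (edgeOf i) = ∑ e : Edge 3 1, F e :=
  Equiv.sum_comp edgeFin.symm F

/-- ★★ **Lipschitz bound for `g = transplantObsL L Λ R f i` on `Cfg`, uniformly in `L ≥ 1`**: there is `Lg ≥ 0` (depending on `Λ, R, f, i` only) with
`(g(W⃗) − g(W⃗'))² ≤ Lg·Σ_e ‖W_e − W'_e‖_F²` for all `W⃗, W⃗'` whose links are off the equator `{u₀ = 0}`. [cite: Luscher1983, §2–§3] -/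
theorem shadowObs_sub_sq_le {Λ R : ℝ} (hΛ : 0 < Λ) (hR1 : 1 ≤ R) (hRΛ : R * Λ ≤ 1 / 4) {f : Fin (k + 1) → ZM → ℝ} (hf : IsEigenFamily k f)
    (hpos : ∀ x, 0 < f 0 x) (i : Fin k) :
    ∃ Lg : ℝ, 0 ≤ Lg ∧ ∀ (L : ℕ), 1 ≤ L → ∀ U V : Cfg, (∀ e, scalarPart (U e) ≠ 0) → (∀ e, scalarPart (V e) ≠ 0) →
      (transplantObsL L Λ R f i U - transplantObsL L Λ R f i V) ^ 2 ≤
        Lg * ∑ e : Edge 3 1, frobNorm (((U e : SU2) : Matrix (Fin 2) (Fin 2) ℂ) - ((V e : SU2) : Matrix (Fin 2) (Fin 2) ℂ)) ^ 2 := by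
  have hR : 0 < R := lt_of_lt_of_le one_pos hR1
  set μ : ℝ := Λ / 2 with hμdef
  have hμ : 0 < μ := by positivity
  obtain ⟨K, C, hC0, hK, hC⟩ := exists_lipschitzWith_transplantFn hR hf hpos i
  refine ⟨114 * (K : ℝ) ^ 2 / μ ^ 2 + 64 * C ^ 2, by positivity, fun L hL U V hU hV => ?_⟩
  set S := ∑ e : Edge 3 1, frobNorm (((U e : SU2) : Matrix (Fin 2) (Fin 2) ℂ) - ((V e : SU2) : Matrix (Fin 2) (Fin 2) ℂ)) ^ 2 with hS
  have hS0 : 0 ≤ S := Finset.sum_nonneg fun _ _ => sq_nonneg _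
  set a := transplantObsL L Λ R f i U with ha
  set b := transplantObsL L Λ R f i V with hb
  have haC : |a| ≤ C := hC _
  have hbC : |b| ≤ C := hC _
  have hLg1 : 0 ≤ 114 * (K : ℝ) ^ 2 / μ ^ 2 := by positivity
  -- case: both vanish
  by_cases hab : a = 0 ∧ b = 0
  · rw [hab.1, hab.2, sub_zero, zero_pow two_ne_zero]
    exact mul_nonneg (by positivity) hS0
  -- case: a far link
  by_cases hfar : ∃ e : Edge 3 1, 1 / 16 < frobNorm (((U e : SU2) : Matrix (Fin 2) (Fin 2) ℂ) - ((V e : SU2) : Matrix (Fin 2) (Fin 2) ℂ)) ^ 2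
  · obtain ⟨e, he⟩ := hfar
    have hSe : frobNorm (((U e : SU2) : Matrix (Fin 2) (Fin 2) ℂ) - ((V e : SU2) : Matrix (Fin 2) (Fin 2) ℂ)) ^ 2 ≤ S :=
      Finset.single_le_sum (f := fun e => frobNorm (((U e : SU2) : Matrix (Fin 2) (Fin 2) ℂ) - ((V e : SU2) : Matrix (Fin 2) (Fin 2) ℂ)) ^ 2)
        (fun _ _ => sq_nonneg _) (Finset.mem_univ e)
    have h1 : (a - b) ^ 2 ≤ 4 * C ^ 2 := by
      have hab2 : |a - b| ≤ 2 * C := (abs_sub a b).trans (by linarith)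
      have := pow_le_pow_left₀ (abs_nonneg _) hab2 2
      rw [sq_abs] at this
      linarith
    have hS16 : (0 : ℝ) ≤ 16 * S - 1 := by linarith
    calc (a - b) ^ 2 ≤ 4 * C ^ 2 := h1
      _ ≤ 64 * C ^ 2 * S := by nlinarith [mul_nonneg (sq_nonneg C) hS16]
      _ ≤ (114 * (K : ℝ) ^ 2 / μ ^ 2 + 64 * C ^ 2) * S := by nlinarith [mul_nonneg hLg1 hS0]
  -- case: all links close, one of `a, b` non-zero: both configurations lie in the same polar caps
  push Not at hfar
  have hcaps : ∀ j : Fin 3, 3 / 4 ≤ |scalarPart (U (edgeOf j))| ∧ 3 / 4 ≤ |scalarPart (V (edgeOf j))| ∧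
      0 < scalarPart (U (edgeOf j)) * scalarPart (V (edgeOf j)) := by
    intro j
    rcases not_and_or.1 hab with ha0 | hb0
    · have hUj := abs_scalarPart_ge_of_transplantObsL_ne_zero hL hΛ hR1 hRΛ f i hU ha0 j
      obtain ⟨hVj, hsgn⟩ := scalarPart_close hUj (hfar (edgeOf j))
      exact ⟨le_trans (by norm_num) hUj, hVj, hsgn⟩
    · have hVj := abs_scalarPart_ge_of_transplantObsL_ne_zero hL hΛ hR1 hRΛ f i hV hb0 j
      have hd : frobNorm (((V (edgeOf j) : SU2) : Matrix (Fin 2) (Fin 2) ℂ) - ((U (edgeOf j) : SU2) : Matrix (Fin 2) (Fin 2) ℂ)) ^ 2 ≤ 1 / 16 := by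
        rw [← neg_sub, frobNorm_neg]; exact hfar (edgeOf j)
      obtain ⟨hUj, hsgn⟩ := scalarPart_close hVj hd
      exact ⟨hUj, le_trans (by norm_num) hVj, by rw [mul_comm]; exact hsgn⟩
  -- flip into the upper hemisphere and apply the chart Lipschitz bound
  have hU' : ∀ j, 3 / 4 ≤ scalarPart (capFlip U (edgeOf j)) := fun j => by rw [scalarPart_capFlip]; exact (hcaps j).1
  have hV' : ∀ j, 3 / 4 ≤ scalarPart (capFlip V (edgeOf j)) := fun j => by rw [scalarPart_capFlip]; exact (hcaps j).2.1
  have hchart := norm_rootCoord_sub_sq_le hL hμ hU' hV'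
  rw [rootCoord_capFlip, rootCoord_capFlip] at hchart
  have hsum : ∑ j : Fin 3, frobNorm (((capFlip U (edgeOf j) : SU2) : Matrix (Fin 2) (Fin 2) ℂ) -
      ((capFlip V (edgeOf j) : SU2) : Matrix (Fin 2) (Fin 2) ℂ)) ^ 2 = S := by
    rw [hS, ← sum_edgeOf_eq]
    exact Finset.sum_congr rfl fun j _ => by rw [frobNorm_capFlip_sub (hcaps j).2.2]
  rw [hsum] at hchart
  -- Lipschitz of the flat observable
  have hlip : (a - b) ^ 2 ≤ (K : ℝ) ^ 2 * ‖rootCoord L μ U - rootCoord L μ V‖ ^ 2 := by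
    have h1 := hK.dist_le_mul (rootCoord L μ U) (rootCoord L μ V)
    rw [Real.dist_eq, dist_eq_norm] at h1
    have h2 : |a - b| ≤ (K : ℝ) * ‖rootCoord L μ U - rootCoord L μ V‖ := h1
    have h3 := pow_le_pow_left₀ (abs_nonneg _) h2 2
    rw [sq_abs, mul_pow] at h3
    exact h3
  calc (a - b) ^ 2 ≤ (K : ℝ) ^ 2 * ‖rootCoord L μ U - rootCoord L μ V‖ ^ 2 := hlip
    _ ≤ (K : ℝ) ^ 2 * (114 / μ ^ 2 * S) := mul_le_mul_of_nonneg_left hchart (sq_nonneg _)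
    _ = 114 * (K : ℝ) ^ 2 / μ ^ 2 * S := by ring
    _ ≤ (114 * (K : ℝ) ^ 2 / μ ^ 2 + 64 * C ^ 2) * S := by nlinarith [mul_nonneg (mul_nonneg (by norm_num : (0:ℝ) ≤ 64) (sq_nonneg C)) hS0]

/-! ## §5 ★★★ F8c: the shadow observable `g ∘ powLink L` -/

/-- ★★★ **LIPSCHITZ OF THE SHADOW OBSERVABLE** (W2-F8c): for `g = transplantObsL L Λ R f i` there is `Lg ≥ 0` depending on `Λ, R, f, i` ONLY such that for
every `L ≥ 1` and all `U, V ∈ Cfg` whose `L`-th powers are off the equator,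
`(g(powLink L U) − g(powLink L V))² ≤ Lg · L² · cfgDist U V`
(part 2 of the proof: §4 at `U^L, V^L`, then `‖U^L − V^L‖_F ≤ L‖U − V‖_F = L‖UV⁻¹ − 1‖_F`). [cite: Luscher1983, §2–§3] -/
theorem shadowObs_powLink_sub_sq_le {Λ R : ℝ} (hΛ : 0 < Λ) (hR1 : 1 ≤ R) (hRΛ : R * Λ ≤ 1 / 4) {f : Fin (k + 1) → ZM → ℝ} (hf : IsEigenFamily k f)
    (hpos : ∀ x, 0 < f 0 x) (i : Fin k) :
    ∃ Lg : ℝ, 0 ≤ Lg ∧ ∀ (L : ℕ), 1 ≤ L → ∀ U V : Cfg, (∀ e, scalarPart (U e ^ L) ≠ 0) → (∀ e, scalarPart (V e ^ L) ≠ 0) →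
      (transplantObsL L Λ R f i (powLink L U) - transplantObsL L Λ R f i (powLink L V)) ^ 2 ≤ Lg * (L : ℝ) ^ 2 * cfgDist U V := by
  obtain ⟨Lg, hLg, h⟩ := shadowObs_sub_sq_le hΛ hR1 hRΛ hf hpos i
  refine ⟨Lg, hLg, fun L hL U V hU hV => ?_⟩
  have hU' : ∀ e, scalarPart (powLink L U e) ≠ 0 := fun e => by rw [powLink_apply]; exact hU e
  have hV' : ∀ e, scalarPart (powLink L V e) ≠ 0 := fun e => by rw [powLink_apply]; exact hV e
  have hmain := h L hL (powLink L U) (powLink L V) hU' hV'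
  have hpow : ∑ e : Edge 3 1, frobNorm (((powLink L U e : SU2) : Matrix (Fin 2) (Fin 2) ℂ) - ((powLink L V e : SU2) : Matrix (Fin 2) (Fin 2) ℂ)) ^ 2 ≤
      (L : ℝ) ^ 2 * cfgDist U V := by
    unfold cfgDist
    rw [Finset.mul_sum]
    refine Finset.sum_le_sum fun e _ => ?_
    rw [powLink_apply, powLink_apply, ← frobNorm_sub_eq_mul_inv]
    have h1 := frobNorm_pow_sub_pow_le (U e) (V e) L
    have h2 := pow_le_pow_left₀ (frobNorm_nonneg _) h1 2
    rw [mul_pow] at h2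
    exact h2
  calc _ ≤ Lg * ∑ e : Edge 3 1, frobNorm (((powLink L U e : SU2) : Matrix (Fin 2) (Fin 2) ℂ) - ((powLink L V e : SU2) : Matrix (Fin 2) (Fin 2) ℂ)) ^ 2 := hmain
    _ ≤ Lg * ((L : ℝ) ^ 2 * cfgDist U V) := mul_le_mul_of_nonneg_left hpow hLg
    _ = Lg * (L : ℝ) ^ 2 * cfgDist U V := by ring

end Summit.QuantumFields.YangMills.Theorems.FemtoTransferGap.PolyakovLift

end
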